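import Mathlib
import Summits.NavierStokesRegularity.NavierStokesRegularity.Theorems.EulerZoomLiouvillePowerGaugeEulerLiouvilleRadialVirial

/-!
# R49/R50 plates, the TRANSPORT PAIR: gradient-test and radial virial identities VERBATIM for `(W, Π̂)`
# (nsreg-p2 ROUND-49 «EVERY BALL BREATHES» / ROUND-50 §4; seat ns-ezl-w2 g6, `--supports stmt-NavierStokesRegularity-19832 --as helper`)

Let `(V, P)` be a `γ`-profile with similarity centre `c` (`IsSelfSimilarEulerProfile γ c V P`), `W = γ(y − c) + V` its transport
field and `Π = P − ½γ(1−γ)‖y − c‖²` the modified pressure.  Then `DW[W] + (1−2γ)W + ∇Π = 0` and `div W = 3γ`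
(`transport_profile_eq`, `divergence_transport`), so testing against a gradient `∇X`, `X ∈ C²_c`, gives
`∫ ⟪W, D(∇X)[W]⟫ + ∫ Π ΔX = 3γ(5γ−1) ∫ X` (`integral_transport_gradientTest`).  Since `∫ ‖y − x₀‖² ΔX = 6 ∫ X`
(`integral_norm_sub_sq_mul_laplacian`), the CENTRE-DEPENDENT modified pressure

  `Π̂_{x₀} := Π − ½γ(5γ−1)‖y − x₀‖²`

satisfies the V-form GRADIENT-TEST IDENTITY verbatim (`transportGradientTestIdentity`):
`∫ (⟪W, D(∇X)[W]⟫ + Π̂_{x₀} · div ∇X) = 0` for every `X ∈ C²_c` — and hence (`radialVirial_of_gradientTest`, the proof of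
ns-ezl-w2 g5's `radialVirialIdentity` run for an arbitrary pair) the RADIAL VIRIAL IDENTITY verbatim about `x₀`
(`transportRadialVirialIdentity`).  Consequently every `(W, Π)`-form plate of R49/R50 (transport mean-value formula, transport
sphere/ball laws, knot ventilation, the `α`-family `TransportShellLaw`, the ball cap identity) is the corresponding V-form statement
applied to the pair `(W, Π̂_{x₀})` plus explicit radial moments of `‖y − x₀‖^k`; the `α`-uniform coefficient `γ(5γ−1)` of R50 §4 is
this one shift.  (`W` and `Π̂` are written UNFOLDED, so `NsregP2.R49.transportW` / `Literature…selfSimilarTransport` instances are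
definitional.)

HONEST FRAMING: whole-space integration by parts (ROUND-49/50 instrument statements); nothing about the crux E (19832 OPEN) or NS
regularity. [cite: ChaeWolf2016, §2 (weak pressure equation, radial tests)] [folklore]
-/

noncomputable section

set_option linter.dupNamespace false

open MeasureTheory Set Filter Topology Metric Function TopologicalSpace
open scoped ENNReal NNReal RealInnerProductSpace ContDiff Laplacian

namespace Summit.NavierStokesRegularity.NavierStokesRegularity.Theorems.PowerGaugeEulerLiouville

open Literature.Analysis Literature.Analysis.FunctionSpaces Literature.Analysis.FluidPDE

namespace ClassicalProfile

/-! ## The radial virial identity from a gradient-test identity, for an arbitrary pair `(U, Q)` -/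

/-- **Radial virial from gradient tests.**  If a pair `(U, Q)` satisfies `∫ (⟪U, D(∇X)[U]⟫ + Q · div ∇X) = 0` for every
`X ∈ C²_c(ℝ³)`, then about every point `x₀`, for every weight `ψ ∈ C¹_c(ℝ)` evaluated at `‖z‖²`, `z = y − x₀`:
`∫ ( ψ(‖z‖²)‖U‖² + 2ψ′(‖z‖²)⟪U, z⟫² + Q (3ψ(‖z‖²) + 2‖z‖²ψ′(‖z‖²)) ) dy = 0`
(test with `X = ½Ψ(‖z‖²)`, `Ψ′ = ψ`: `∇X = ψ z`, `D(∇X)[U] = ψU + 2ψ′⟪z,U⟫z`, `div ∇X = 3ψ + 2‖z‖²ψ′`; this is the proof of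
`radialVirialIdentity` (ns-ezl-w2 g5) with the profile replaced by the hypothesis). [cite: ChaeWolf2016, §2] [folklore] -/
theorem radialVirial_of_gradientTest {U : EuclideanSpace ℝ (Fin 3) → EuclideanSpace ℝ (Fin 3)} {Q : EuclideanSpace ℝ (Fin 3) → ℝ}
    (hGT : ∀ X : EuclideanSpace ℝ (Fin 3) → ℝ, ContDiff ℝ 2 X → HasCompactSupport X →
      ∫ y, (⟪U y, fderiv ℝ (gradient X) y (U y)⟫ + Q y * VectorCalculus.divergence (gradient X) y) = 0)
    (x₀ : EuclideanSpace ℝ (Fin 3)) {ψ : ℝ → ℝ} (hψ : ContDiff ℝ 1 ψ) (hψc : HasCompactSupport ψ) :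
    ∫ y, (ψ (‖y - x₀‖ ^ 2) * ‖U y‖ ^ 2
            + 2 * deriv ψ (‖y - x₀‖ ^ 2) * ⟪U y, y - x₀⟫ ^ 2
            + Q y * (3 * ψ (‖y - x₀‖ ^ 2) + 2 * ‖y - x₀‖ ^ 2 * deriv ψ (‖y - x₀‖ ^ 2))) = 0 := by
  obtain ⟨X, hX, hXc, hgrad⟩ := exists_radial_test hψ hψc x₀
  have hG : gradient X = fun y => ψ (‖y - x₀‖ ^ 2) • (y - x₀) := funext fun y => (hgrad y).gradient
  -- the differential of `∇X = ψ(‖z‖²) z`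
  have hψd : ∀ s, HasDerivAt ψ (deriv ψ s) s := fun s => ((hψ.differentiable one_ne_zero) s).hasDerivAt
  have hDG : ∀ y w, fderiv ℝ (gradient X) y w =
      ψ (‖y - x₀‖ ^ 2) • w + (2 * deriv ψ (‖y - x₀‖ ^ 2) * ⟪y - x₀, w⟫) • (y - x₀) := by
    intro y w
    have hn : HasFDerivAt (fun y : EuclideanSpace ℝ (Fin 3) => ‖y - x₀‖ ^ 2)
        ((2 : ℕ) • (innerSL ℝ (y - x₀)).comp (ContinuousLinearMap.id ℝ (EuclideanSpace ℝ (Fin 3)))) y :=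
      ((hasFDerivAt_id y).sub_const x₀).norm_sq
    have hs : HasFDerivAt (fun y : EuclideanSpace ℝ (Fin 3) => ψ (‖y - x₀‖ ^ 2))
        (deriv ψ (‖y - x₀‖ ^ 2) • ((2 : ℕ) • (innerSL ℝ (y - x₀)).comp
          (ContinuousLinearMap.id ℝ (EuclideanSpace ℝ (Fin 3))))) y :=
      (hψd _).comp_hasFDerivAt y hn
    have hv : HasFDerivAt (fun y : EuclideanSpace ℝ (Fin 3) => y - x₀)
        (ContinuousLinearMap.id ℝ (EuclideanSpace ℝ (Fin 3))) y := (hasFDerivAt_id y).sub_const x₀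
    have h : HasFDerivAt (fun y : EuclideanSpace ℝ (Fin 3) => ψ (‖y - x₀‖ ^ 2) • (y - x₀))
        (ψ (‖y - x₀‖ ^ 2) • ContinuousLinearMap.id ℝ (EuclideanSpace ℝ (Fin 3)) +
          (deriv ψ (‖y - x₀‖ ^ 2) • ((2 : ℕ) • (innerSL ℝ (y - x₀)).comp
            (ContinuousLinearMap.id ℝ (EuclideanSpace ℝ (Fin 3))))).smulRight (y - x₀)) y := hs.smul hv
    rw [hG, h.fderiv]
    rw [two_nsmul]
    simp only [_root_.add_apply, _root_.smul_apply, ContinuousLinearMap.smulRight_apply, ContinuousLinearMap.comp_apply,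
      ContinuousLinearMap.id_apply, innerSL_apply_apply, smul_eq_mul]
    congr 1
    ring_nf
  -- the two integrands agree pointwise
  have hpt : ∀ y, ⟪U y, fderiv ℝ (gradient X) y (U y)⟫ + Q y * VectorCalculus.divergence (gradient X) y =
      ψ (‖y - x₀‖ ^ 2) * ‖U y‖ ^ 2 + 2 * deriv ψ (‖y - x₀‖ ^ 2) * ⟪U y, y - x₀⟫ ^ 2 +
        Q y * (3 * ψ (‖y - x₀‖ ^ 2) + 2 * ‖y - x₀‖ ^ 2 * deriv ψ (‖y - x₀‖ ^ 2)) := by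
    intro y
    have hdiv : VectorCalculus.divergence (gradient X) y =
        3 * ψ (‖y - x₀‖ ^ 2) + 2 * ‖y - x₀‖ ^ 2 * deriv ψ (‖y - x₀‖ ^ 2) := by
      rw [divergence_eq_sum_inner_fderiv (EuclideanSpace.basisFun (Fin 3) ℝ)]
      have hon : ∀ i, ⟪(EuclideanSpace.basisFun (Fin 3) ℝ) i, (EuclideanSpace.basisFun (Fin 3) ℝ) i⟫ = (1 : ℝ) := by
        intro i
        have h := orthonormal_iff_ite.mp (EuclideanSpace.basisFun (Fin 3) ℝ).orthonormal i i
        rwa [if_pos rfl] at h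
      have hsum := (EuclideanSpace.basisFun (Fin 3) ℝ).sum_inner_mul_inner (y - x₀) (y - x₀)
      rw [real_inner_self_eq_norm_sq] at hsum
      have hterm : ∀ i, ⟪(EuclideanSpace.basisFun (Fin 3) ℝ) i, fderiv ℝ (gradient X) y ((EuclideanSpace.basisFun (Fin 3) ℝ) i)⟫ =
          ψ (‖y - x₀‖ ^ 2) + 2 * deriv ψ (‖y - x₀‖ ^ 2) *
            (⟪y - x₀, (EuclideanSpace.basisFun (Fin 3) ℝ) i⟫ * ⟪(EuclideanSpace.basisFun (Fin 3) ℝ) i, y - x₀⟫) := by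
        intro i
        rw [hDG, inner_add_right, inner_smul_right, inner_smul_right, hon i]
        ring
      simp_rw [hterm]
      rw [Finset.sum_add_distrib, Finset.sum_const, Finset.card_univ, Fintype.card_fin, ← Finset.mul_sum, hsum, nsmul_eq_mul,
        Nat.cast_ofNat]
      ring
    rw [hdiv, hDG, inner_add_right, inner_smul_right, inner_smul_right, real_inner_self_eq_norm_sq, real_inner_comm (y - x₀)]
    ring
  have h := hGT X hX hXc
  rw [integral_congr_ae (Eventually.of_forall hpt)] at h
  exact h

/-! ## The transport pair `(W, Π)` of a profile -/

section Transport

variable {γ : ℝ} {c : EuclideanSpace ℝ (Fin 3)} {V : EuclideanSpace ℝ (Fin 3) → EuclideanSpace ℝ (Fin 3)}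
  {P : EuclideanSpace ℝ (Fin 3) → ℝ}

/-- The transport field `W = γ(y − c) + V` is as smooth as `V`. [folklore] -/
theorem contDiff_transport {n : WithTop ℕ∞} (hV : ContDiff ℝ n V) (γ : ℝ) (c : EuclideanSpace ℝ (Fin 3)) :
    ContDiff ℝ n (fun y : EuclideanSpace ℝ (Fin 3) => γ • (y - c) + V y) :=
  ((contDiff_id.sub contDiff_const).const_smul γ).add hV

/-- The differential of the transport field: `DW(y) = γ·Id + DV(y)`. [folklore] -/
theorem hasFDerivAt_transport {y : EuclideanSpace ℝ (Fin 3)} (hV : DifferentiableAt ℝ V y) (γ : ℝ)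
    (c : EuclideanSpace ℝ (Fin 3)) :
    HasFDerivAt (fun y : EuclideanSpace ℝ (Fin 3) => γ • (y - c) + V y)
      (γ • ContinuousLinearMap.id ℝ (EuclideanSpace ℝ (Fin 3)) + fderiv ℝ V y) y :=
  (((hasFDerivAt_id y).sub_const c).const_smul γ).add hV.hasFDerivAt

/-- `DW(y) = γ·Id + DV(y)` as an equation for `fderiv`. [folklore] -/
theorem fderiv_transport {y : EuclideanSpace ℝ (Fin 3)} (hV : DifferentiableAt ℝ V y) (γ : ℝ)
    (c : EuclideanSpace ℝ (Fin 3)) :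
    fderiv ℝ (fun y : EuclideanSpace ℝ (Fin 3) => γ • (y - c) + V y) y =
      γ • ContinuousLinearMap.id ℝ (EuclideanSpace ℝ (Fin 3)) + fderiv ℝ V y :=
  (hasFDerivAt_transport hV γ c).fderiv

/-- **`div W = 3γ`** for the transport field of a divergence-free `V` on `ℝ³`. [folklore] -/
theorem divergence_transport {y : EuclideanSpace ℝ (Fin 3)} (hV : DifferentiableAt ℝ V y)
    (hdiv : VectorCalculus.divergence V y = 0) (γ : ℝ) (c : EuclideanSpace ℝ (Fin 3)) :
    VectorCalculus.divergence (fun y : EuclideanSpace ℝ (Fin 3) => γ • (y - c) + V y) y = 3 * γ := by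
  have hid := Sverak2011.divergence_id_three y
  rw [VectorCalculus.divergence, fderiv_fun_id] at hid
  rw [VectorCalculus.divergence] at hdiv
  rw [VectorCalculus.divergence, fderiv_transport hV γ c, ContinuousLinearMap.toLinearMap_add,
    ContinuousLinearMap.toLinearMap_smul, map_add, map_smul, hdiv]
  have : LinearMap.trace ℝ (EuclideanSpace ℝ (Fin 3)) ↑(ContinuousLinearMap.id ℝ (EuclideanSpace ℝ (Fin 3))) = 3 := hid
  rw [this, smul_eq_mul, add_zero, mul_comm]

/-- The gradient of `y ↦ κ/2 · ‖y − a‖²` is `κ (y − a)`. [folklore] -/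
theorem hasGradientAt_const_mul_norm_sub_sq (κ : ℝ) (a y : EuclideanSpace ℝ (Fin 3)) :
    HasGradientAt (fun y : EuclideanSpace ℝ (Fin 3) => κ / 2 * ‖y - a‖ ^ 2) (κ • (y - a)) y := by
  have hn : HasFDerivAt (fun y : EuclideanSpace ℝ (Fin 3) => ‖y - a‖ ^ 2)
      ((2 : ℕ) • (innerSL ℝ (y - a)).comp (ContinuousLinearMap.id ℝ (EuclideanSpace ℝ (Fin 3)))) y :=
    ((hasFDerivAt_id y).sub_const a).norm_sq
  have h1 := hn.const_mul (κ / 2)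
  rw [hasGradientAt_iff_hasFDerivAt]
  refine h1.congr_fderiv ?_
  ext v
  rw [two_nsmul]
  simp only [_root_.smul_apply, _root_.add_apply, ContinuousLinearMap.comp_apply, ContinuousLinearMap.id_apply,
    innerSL_apply_apply, smul_eq_mul, InnerProductSpace.toDual_apply_apply, real_inner_smul_left]
  ring

/-- `y ↦ κ/2 · ‖y − a‖²` is smooth. [folklore] -/
theorem contDiff_const_mul_norm_sub_sq {n : WithTop ℕ∞} (κ : ℝ) (a : EuclideanSpace ℝ (Fin 3)) :
    ContDiff ℝ n (fun y : EuclideanSpace ℝ (Fin 3) => κ / 2 * ‖y - a‖ ^ 2) :=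
  contDiff_const.mul ((contDiff_norm_sq ℝ).comp (contDiff_id.sub contDiff_const))

/-- The gradient of the modified pressure `Π = P − ½γ(1−γ)‖y − c‖²`: `∇Π = ∇P − γ(1−γ)(y − c)`. [folklore] -/
theorem gradient_modPressure {y : EuclideanSpace ℝ (Fin 3)} (hP : DifferentiableAt ℝ P y) (γ : ℝ)
    (c : EuclideanSpace ℝ (Fin 3)) :
    gradient (fun y : EuclideanSpace ℝ (Fin 3) => P y - γ * (1 - γ) / 2 * ‖y - c‖ ^ 2) y =
      gradient P y - (γ * (1 - γ)) • (y - c) := by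
  have hq := hasGradientAt_const_mul_norm_sub_sq (γ * (1 - γ)) c y
  rw [← hq.gradient, gradient, gradient, gradient, ← map_sub, fderiv_fun_sub hP hq.differentiableAt]

/-- **The profile equation in transport variables**: `DW[W] + (1−2γ)W + ∇Π = 0` pointwise, with `W = γ(y − c) + V`,
`Π = P − ½γ(1−γ)‖y − c‖²` (`DV[W] = DW[W] − γW`, `(1−γ)V = (1−γ)W − γ(1−γ)(y − c)`, `∇(½γ(1−γ)‖y − c‖²) = γ(1−γ)(y − c)`).
[cite: ChaeWolf2016, §2] [folklore] -/
theorem transport_profile_eq (hprof : IsSelfSimilarEulerProfile γ c V P) (y : EuclideanSpace ℝ (Fin 3)) :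
    fderiv ℝ (fun y : EuclideanSpace ℝ (Fin 3) => γ • (y - c) + V y) y (γ • (y - c) + V y)
      + (1 - 2 * γ) • (γ • (y - c) + V y)
      + gradient (fun y : EuclideanSpace ℝ (Fin 3) => P y - γ * (1 - γ) / 2 * ‖y - c‖ ^ 2) y = 0 := by
  have hV : DifferentiableAt ℝ V y := hprof.differentiable_velocity y
  have hP : DifferentiableAt ℝ P y := hprof.differentiable_pressure y
  rw [fderiv_transport hV, gradient_modPressure hP]
  have key := hprof.profile_eq y
  simp only [_root_.add_apply, _root_.smul_apply, ContinuousLinearMap.id_apply]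
  calc γ • (γ • (y - c) + V y) + fderiv ℝ V y (γ • (y - c) + V y) + (1 - 2 * γ) • (γ • (y - c) + V y)
        + (gradient P y - (γ * (1 - γ)) • (y - c))
      = (1 - γ) • V y + fderiv ℝ V y (γ • (y - c) + V y) + gradient P y := by module
    _ = 0 := key

end Transport

/-! ## Integrals against gradients for the transport pair -/

section Integrals

variable {γ : ℝ} {c : EuclideanSpace ℝ (Fin 3)} {V : EuclideanSpace ℝ (Fin 3) → EuclideanSpace ℝ (Fin 3)}
  {P X : EuclideanSpace ℝ (Fin 3) → ℝ}

/-- `∫ ⟪U, ∇θ⟫ = −κ ∫ θ` for `U ∈ C¹` with constant divergence `κ` and `θ ∈ C¹_c`. [folklore] -/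
theorem integral_inner_gradient_eq_of_divergence_eq_const {U : EuclideanSpace ℝ (Fin 3) → EuclideanSpace ℝ (Fin 3)}
    {θ : EuclideanSpace ℝ (Fin 3) → ℝ} {κ : ℝ} (hU : ContDiff ℝ 1 U) (hdiv : ∀ y, VectorCalculus.divergence U y = κ)
    (hθ : ContDiff ℝ 1 θ) (hθc : HasCompactSupport θ) :
    ∫ y, ⟪U y, gradient θ y⟫ = -(κ * ∫ y, θ y) := by
  have h := integral_mul_divergence_add_eq_zero_left hθ hU hθc
  simp only [hdiv] at h
  rw [integral_mul_const] at h
  linarith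

/-- `∫ ⟪y − x₀, ∇θ⟫ = −3 ∫ θ` for `θ ∈ C¹_c(ℝ³)`. [folklore] -/
theorem integral_inner_sub_gradient (hθ : ContDiff ℝ 1 X) (hθc : HasCompactSupport X) (x₀ : EuclideanSpace ℝ (Fin 3)) :
    ∫ y, ⟪y - x₀, gradient X y⟫ = -(3 * ∫ y, X y) := by
  have hU : ContDiff ℝ 1 (fun y : EuclideanSpace ℝ (Fin 3) => y - x₀) := contDiff_id.sub contDiff_const
  refine integral_inner_gradient_eq_of_divergence_eq_const hU (fun y => ?_) hθ hθc
  have hid := Sverak2011.divergence_id_three y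
  rw [VectorCalculus.divergence, fderiv_fun_id] at hid
  rw [VectorCalculus.divergence, fderiv_sub_const, fderiv_fun_id]
  exact hid

/-- **`∫ ‖y − x₀‖² ΔX = 6 ∫ X`** for `X ∈ C²_c(ℝ³)` (`∇‖y − x₀‖² = 2(y − x₀)`, `div (y − x₀) = 3`). [folklore] -/
theorem integral_norm_sub_sq_mul_laplacian (hX : ContDiff ℝ 2 X) (hXc : HasCompactSupport X) (x₀ : EuclideanSpace ℝ (Fin 3)) :
    ∫ y, ‖y - x₀‖ ^ 2 * (Δ X) y = 6 * ∫ y, X y := by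
  have hX1 : ContDiff ℝ 1 X := hX.of_le (by norm_cast)
  have hρ : ContDiff ℝ 1 (fun y : EuclideanSpace ℝ (Fin 3) => (2 : ℝ) / 2 * ‖y - x₀‖ ^ 2) := contDiff_const_mul_norm_sub_sq 2 x₀
  have h := integral_inner_gradient_gradient hρ hX hXc
  have hg : ∀ y, gradient (fun y : EuclideanSpace ℝ (Fin 3) => (2 : ℝ) / 2 * ‖y - x₀‖ ^ 2) y = (2 : ℝ) • (y - x₀) := fun y =>
    (hasGradientAt_const_mul_norm_sub_sq 2 x₀ y).gradient
  simp only [hg, real_inner_smul_left, integral_const_mul, integral_inner_sub_gradient hX1 hXc x₀] at h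
  have h2 : ∫ y, (2 : ℝ) / 2 * ‖y - x₀‖ ^ 2 * (Δ X) y = ∫ y, ‖y - x₀‖ ^ 2 * (Δ X) y :=
    integral_congr_ae (Eventually.of_forall fun y => by ring)
  linarith

/-- **The transport system tested against a gradient**: for a `γ`-profile and `X ∈ C²_c`,
`∫ ⟪W, D(∇X)[W]⟫ + ∫ Π ΔX = 3γ(5γ−1) ∫ X` (trilinear identity with `div W = 3γ`, `∫⟪W,∇X⟫ = −3γ∫X`, `∫⟪∇Π,∇X⟫ = −∫ΠΔX`).
[cite: ChaeWolf2016, §2] [folklore] -/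
theorem integral_transport_gradientTest (hprof : IsSelfSimilarEulerProfile γ c V P) (hX : ContDiff ℝ 2 X)
    (hXc : HasCompactSupport X) :
    (∫ y, ⟪γ • (y - c) + V y, fderiv ℝ (gradient X) y (γ • (y - c) + V y)⟫)
      + ∫ y, (P y - γ * (1 - γ) / 2 * ‖y - c‖ ^ 2) * (Δ X) y = 3 * γ * (5 * γ - 1) * ∫ y, X y := by
  set W : EuclideanSpace ℝ (Fin 3) → EuclideanSpace ℝ (Fin 3) := fun y => γ • (y - c) + V y with hW
  set Pm : EuclideanSpace ℝ (Fin 3) → ℝ := fun y => P y - γ * (1 - γ) / 2 * ‖y - c‖ ^ 2 with hPm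
  have hV1 : ContDiff ℝ 1 V := hprof.contDiff_velocity.of_le (by norm_cast)
  have hW1 : ContDiff ℝ 1 W := contDiff_transport hV1 γ c
  have hPm1 : ContDiff ℝ 1 Pm := hprof.contDiff_pressure.sub (contDiff_const_mul_norm_sub_sq _ c)
  have hX1 : ContDiff ℝ 1 X := hX.of_le (by norm_cast)
  have hdivW : ∀ y, VectorCalculus.divergence W y = 3 * γ := fun y =>
    divergence_transport (hprof.differentiable_velocity y) (hprof.divFree y) γ c
  -- (1) the trilinear identity
  have htri := integral_inner_convect_add_eq_zero hW1 hW1 (contDiff_one_gradient hX) (hasCompactSupport_gradient hXc)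
  simp only [convect_apply, hdivW] at htri
  -- (2) `∫⟪W, ∇X⟫ = −3γ ∫X`
  have hWX : ∫ y, ⟪W y, gradient X y⟫ = -(3 * γ * ∫ y, X y) :=
    integral_inner_gradient_eq_of_divergence_eq_const hW1 hdivW hX1 hXc
  -- (3) `∫⟪∇Π, ∇X⟫ = −∫ Π ΔX`
  have hPX := integral_inner_gradient_gradient hPm1 hX hXc
  -- (4) the transport equation paired with `∇X` and integrated
  have hpt : ∀ y, ⟪fderiv ℝ W y (W y), gradient X y⟫ =
      -((1 - 2 * γ) * ⟪W y, gradient X y⟫) - ⟪gradient Pm y, gradient X y⟫ := by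
    intro y
    have h1 : fderiv ℝ W y (W y) + (1 - 2 * γ) • W y + gradient Pm y = 0 := transport_profile_eq hprof y
    have h := congrArg (fun w => ⟪w, gradient X y⟫) h1
    rw [inner_add_left, inner_add_left, real_inner_smul_left, inner_zero_left] at h
    linarith
  have hiW : Integrable (fun y => ⟪W y, gradient X y⟫) volume :=
    integrable_inner_gradient_of_continuous hW1.continuous hX1 hXc
  have hiP : Integrable (fun y => ⟪gradient Pm y, gradient X y⟫) volume :=
    integrable_inner_gradient_of_continuous (continuous_gradient_of_contDiff hPm1) hX1 hXc
  have hconv : ∫ y, ⟪fderiv ℝ W y (W y), gradient X y⟫ =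
      -((1 - 2 * γ) * ∫ y, ⟪W y, gradient X y⟫) - ∫ y, ⟪gradient Pm y, gradient X y⟫ := by
    have i1 : Integrable (fun y => -((1 - 2 * γ) * ⟪W y, gradient X y⟫)) volume := (hiW.const_mul _).neg
    rw [integral_congr_ae (Eventually.of_forall hpt), integral_sub i1 hiP, integral_neg, integral_const_mul]
  -- (5) combine
  have h3 : ∫ y, 3 * γ * ⟪W y, gradient X y⟫ = 3 * γ * ∫ y, ⟪W y, gradient X y⟫ := integral_const_mul _ _
  rw [h3, hconv, hWX, hPX] at htri
  have hgoal : (∫ y, ⟪W y, fderiv ℝ (gradient X) y (W y)⟫) + ∫ y, Pm y * (Δ X) y = 3 * γ * (5 * γ - 1) * ∫ y, X y := by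
    linarith
  exact hgoal

/-- **TRANSPORT GRADIENT-TEST IDENTITY** (the V-form `GradientTestIdentity` VERBATIM for the pair `(W, Π̂_{x₀})`): for a `γ`-profile
`(V, P)` with centre `c`, every point `x₀` and every `X ∈ C²` with compact support,
`∫ (⟪W, D(∇X)(y)[W]⟫ + Π̂_{x₀} · div ∇X) dy = 0`, where `W = γ(y − c) + V` and
`Π̂_{x₀} = P − ½γ(1−γ)‖y − c‖² − ½γ(5γ−1)‖y − x₀‖²`. [cite: ChaeWolf2016, §2] [folklore] -/
theorem transportGradientTestIdentity (γ : ℝ) :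
    ∀ (c : EuclideanSpace ℝ (Fin 3)) (V : EuclideanSpace ℝ (Fin 3) → EuclideanSpace ℝ (Fin 3)) (P : EuclideanSpace ℝ (Fin 3) → ℝ),
      IsSelfSimilarEulerProfile γ c V P →
      ∀ (x₀ : EuclideanSpace ℝ (Fin 3)) (X : EuclideanSpace ℝ (Fin 3) → ℝ), ContDiff ℝ 2 X → HasCompactSupport X →
        ∫ y, (⟪γ • (y - c) + V y, fderiv ℝ (gradient X) y (γ • (y - c) + V y)⟫
              + (P y - γ * (1 - γ) / 2 * ‖y - c‖ ^ 2 - γ * (5 * γ - 1) / 2 * ‖y - x₀‖ ^ 2)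
                * VectorCalculus.divergence (gradient X) y) = 0 := by
  intro c V P hprof x₀ X hX hXc
  have hV1 : ContDiff ℝ 1 V := hprof.contDiff_velocity.of_le (by norm_cast)
  have hW1 : ContDiff ℝ 1 (fun y : EuclideanSpace ℝ (Fin 3) => γ • (y - c) + V y) := contDiff_transport hV1 γ c
  have hPm : Continuous (fun y : EuclideanSpace ℝ (Fin 3) => P y - γ * (1 - γ) / 2 * ‖y - c‖ ^ 2) :=
    hprof.contDiff_pressure.continuous.sub (contDiff_const_mul_norm_sub_sq (n := 0) _ c).continuous
  have hρ : Continuous (fun y : EuclideanSpace ℝ (Fin 3) => ‖y - x₀‖ ^ 2) := (continuous_id.sub continuous_const).norm.pow 2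
  have hmain := integral_transport_gradientTest hprof hX hXc
  have hsix := integral_norm_sub_sq_mul_laplacian hX hXc x₀
  -- integrability of the three pieces (compact support from `X`)
  have hsuppΔ : HasCompactSupport (Δ X) := by
    refine hXc.mono' fun x hx => ?_
    rw [mem_support] at hx
    contrapose! hx
    exact laplacian_eq_zero_of_notMem_tsupport hx
  have hi1 : Integrable (fun y => ⟪γ • (y - c) + V y, fderiv ℝ (gradient X) y (γ • (y - c) + V y)⟫) volume := by
    refine (hW1.continuous.inner (((contDiff_one_gradient hX).continuous_fderiv one_ne_zero).clm_apply
      hW1.continuous)).integrable_of_hasCompactSupport ?_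
    refine ((hasCompactSupport_gradient hXc).fderiv (𝕜 := ℝ)).mono fun x hx => ?_
    rw [mem_support] at hx ⊢
    contrapose! hx
    simp [hx]
  have hi2 : Integrable (fun y => (P y - γ * (1 - γ) / 2 * ‖y - c‖ ^ 2) * (Δ X) y) volume :=
    (hPm.mul (continuous_laplacian hX)).integrable_of_hasCompactSupport hsuppΔ.mul_left
  have hi3 : Integrable (fun y => ‖y - x₀‖ ^ 2 * (Δ X) y) volume :=
    (hρ.mul (continuous_laplacian hX)).integrable_of_hasCompactSupport hsuppΔ.mul_left
  have hsplit : ∀ y, ⟪γ • (y - c) + V y, fderiv ℝ (gradient X) y (γ • (y - c) + V y)⟫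
      + (P y - γ * (1 - γ) / 2 * ‖y - c‖ ^ 2 - γ * (5 * γ - 1) / 2 * ‖y - x₀‖ ^ 2)
        * VectorCalculus.divergence (gradient X) y =
      ⟪γ • (y - c) + V y, fderiv ℝ (gradient X) y (γ • (y - c) + V y)⟫
        + (P y - γ * (1 - γ) / 2 * ‖y - c‖ ^ 2) * (Δ X) y - γ * (5 * γ - 1) / 2 * (‖y - x₀‖ ^ 2 * (Δ X) y) := by
    intro y
    rw [divergence_gradient hX]
    ring
  have hi12 : Integrable (fun y => ⟪γ • (y - c) + V y, fderiv ℝ (gradient X) y (γ • (y - c) + V y)⟫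
      + (P y - γ * (1 - γ) / 2 * ‖y - c‖ ^ 2) * (Δ X) y) volume := hi1.add hi2
  have hi3' : Integrable (fun y => γ * (5 * γ - 1) / 2 * (‖y - x₀‖ ^ 2 * (Δ X) y)) volume := hi3.const_mul _
  rw [integral_congr_ae (Eventually.of_forall hsplit), integral_sub hi12 hi3', integral_add hi1 hi2, integral_const_mul,
    hmain, hsix]
  ring

/-- **TRANSPORT RADIAL VIRIAL IDENTITY** (the V-form `RadialVirialIdentity` VERBATIM for the pair `(W, Π̂_{x₀})`): for a
`γ`-profile `(V, P)` with centre `c`, every point `x₀` and every weight `ψ ∈ C¹_c(ℝ)` evaluated at `‖z‖²`, `z = y − x₀`: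
`∫ ( ψ‖W‖² + 2ψ′⟪W, z⟫² + Π̂_{x₀}(3ψ + 2‖z‖²ψ′) ) dy = 0`, `W = γ(y − c) + V`,
`Π̂_{x₀} = P − ½γ(1−γ)‖y − c‖² − ½γ(5γ−1)‖z‖²`. [cite: ChaeWolf2016, §2] [folklore] -/
theorem transportRadialVirialIdentity (γ : ℝ) :
    ∀ (c : EuclideanSpace ℝ (Fin 3)) (V : EuclideanSpace ℝ (Fin 3) → EuclideanSpace ℝ (Fin 3)) (P : EuclideanSpace ℝ (Fin 3) → ℝ),
      IsSelfSimilarEulerProfile γ c V P →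
      ∀ (x₀ : EuclideanSpace ℝ (Fin 3)) (ψ : ℝ → ℝ), ContDiff ℝ 1 ψ → HasCompactSupport ψ →
        ∫ y, (ψ (‖y - x₀‖ ^ 2) * ‖γ • (y - c) + V y‖ ^ 2
                + 2 * deriv ψ (‖y - x₀‖ ^ 2) * ⟪γ • (y - c) + V y, y - x₀⟫ ^ 2
                + (P y - γ * (1 - γ) / 2 * ‖y - c‖ ^ 2 - γ * (5 * γ - 1) / 2 * ‖y - x₀‖ ^ 2)
                  * (3 * ψ (‖y - x₀‖ ^ 2) + 2 * ‖y - x₀‖ ^ 2 * deriv ψ (‖y - x₀‖ ^ 2))) = 0 := by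
  intro c V P hprof x₀ ψ hψ hψc
  exact radialVirial_of_gradientTest (U := fun y => γ • (y - c) + V y)
    (Q := fun y => P y - γ * (1 - γ) / 2 * ‖y - c‖ ^ 2 - γ * (5 * γ - 1) / 2 * ‖y - x₀‖ ^ 2)
    (fun X hX hXc => transportGradientTestIdentity γ c V P hprof x₀ X hX hXc) x₀ hψ hψc

end Integrals

end ClassicalProfile

end Summit.NavierStokesRegularity.NavierStokesRegularity.Theorems.PowerGaugeEulerLiouville

end
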